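import Summits.QuantumFields.GaugeBoot.ZdCentralTwistWalks
import HarnessLib

/-!
# The lattice area parity of the `R × T` rectangle is `RT` (gauge-boot, L3 structural supplement;
# `ℤ^d` twist 10)

HONEST FRAMING (cell `pub-gaugeboot`, page 1 of every file): the venture produces certified bounds
on lattice expectations at stated coupling, gauge group, dimension and torus size; NOT a mass gap,
NOT a continuum limit, NOT a string tension; NOT Yang–Mills-summit-bearing (barriers
`FixedCouplingUltralocality`, `PerturbativeInvisibility`). This module bounds no expectation; no
certificate of the cell sits at `β < 0`. Pure lattice-walk combinatorics; no measure, no bound.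

`ZdCentralTwistWalks.lean` (part 8) defined the lattice area parity
`areaParity π w = ∑_{i<k} shoelaceParity π i k w` of a walk of `ℤ^d` and proved that a closed walk
collects exactly `z^{areaParity}` under the Kogut–Susskind twist. This file checks the definition on
the tree's rectangle `rectWalk x i j R T` (`Literature.MathematicalPhysics.QuantumLattice.WilsonLoops`):

* `shoelaceParity_copy`, `shoelaceParity_reverse` (`i ≠ k`: reversal does not change the
  off-diagonal shoelace areas), `shoelaceParity_lineWalk` (`S_{ab}(x → x + n e_i) = [b = i] n π_a(x)`),
  `parity_add_single_natCast`;
* ★ `areaParity_rectWalk` — **`areaParity π (rectWalk x i j R T) = RT (mod 2)`** for `i ≠ j`, every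
  base point and every `d`: the area parity IS the area, consistently with part 7's
  `walkHolonomy_centralTwist_rectWalk`.

[folklore] bookkeeping (the shoelace formula for lattice polygons).
-/

noncomputable section

open MeasureTheory Filter Topology SimpleGraph
open Literature.Probability.LatticeModels (Site zdGraph)
open Literature.MathematicalPhysics.QuantumLattice

namespace Summit.QuantumFields.GaugeBoot

namespace TiltedRP

variable {d N : ℕ} {G : Type*} [Group G]

/-! ## The area parity of the rectangle is `RT` -/

section Rectangle

variable {π : Fin d → Site d →+ ZMod 2}

/-- The shoelace area does not see `Walk.copy`. -/
@[simp] theorem shoelaceParity_copy (i k : Fin d) {x y x' y' : Site d} (p : (zdGraph d).Walk x y)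
    (hx : x = x') (hy : y = y') : shoelaceParity π i k (p.copy hx hy) = shoelaceParity π i k p := by
  subst hx hy; rfl

/-- **Reversal does not change the off-diagonal shoelace areas** (`i ≠ k`): the reversed dart in
direction `k` reads `π_i` at its other endpoint, which has the same `i`-parity. -/
theorem shoelaceParity_reverse (hπ : IsDualParity (zdUnit d) π) {i k : Fin d} (hik : i ≠ k)
    {x y : Site d} (w : (zdGraph d).Walk x y) :
    shoelaceParity π i k w.reverse = shoelaceParity π i k w := by
  unfold shoelaceParity
  rw [Walk.darts_reverse, List.map_reverse, List.sum_reverse, List.map_map]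
  congr 1
  refine List.map_congr_left fun e _ => ?_
  show (if k = dartDir e.symm then π i e.symm.fst else 0) = _
  rw [dartDir_symm]
  split_ifs with hk
  · show π i e.snd = π i e.fst
    rw [parity_snd hπ i e, if_neg (fun h => hik (h.trans hk.symm)), add_zero]
  · rfl

/-- **The shoelace areas of a straight walk**: `S_{ab}(x → x + n e_i) = [b = i] · n · π_a(x)`
(`a ≠ b`). -/
theorem shoelaceParity_lineWalk (hπ : IsDualParity (zdUnit d) π) {a b : Fin d} (hab : a ≠ b)
    (i : Fin d) : ∀ (n : ℕ) (x : Site d),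
      shoelaceParity π a b (lineWalk i n x) = if b = i then (n : ZMod 2) * π a x else 0
  | 0, x => by simp [lineWalk]
  | n + 1, x => by
    rw [lineWalk, shoelaceParity_cons, shoelaceParity_copy, shoelaceParity_lineWalk hπ hab i n,
      dartDir_add_single]
    split_ifs with hb
    · have hπa : π a (x + Pi.single i 1) = π a x := by
        have h := hπ a i
        rw [zdUnit_apply] at h
        rw [map_add, h, if_neg (fun h' => hab (h'.trans hb.symm)), add_zero]
      rw [hπa]
      push_cast
      ring
    · rw [add_zero]

/-- Translating the base point by `n e_j` changes `π_a` by `n [a = j]`. -/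
theorem parity_add_single_natCast (hπ : IsDualParity (zdUnit d) π) (a j : Fin d) (x : Site d)
    (n : ℕ) : π a (x + Pi.single j (n : ℤ)) = π a x + if a = j then (n : ZMod 2) else 0 := by
  have h1 : (x + Pi.single j (n : ℤ) : Site d) = x + n • zdUnit d j := by
    rw [zdUnit_apply, ← Pi.single_smul', nsmul_eq_mul, mul_one]
  rw [h1, map_add, map_nsmul, hπ a j]
  split_ifs <;> simp

/-- ★ **The lattice area parity of the `R × T` rectangle is `RT`** (`i ≠ j`; any base point, any
`d`): the definition `areaParity` is the area. -/
theorem areaParity_rectWalk (hπ : IsDualParity (zdUnit d) π) (x : Site d) {i j : Fin d}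
    (hij : i ≠ j) (R T : ℕ) :
    areaParity π (rectWalk x i j R T) = ((R * T : ℕ) : ZMod 2) := by
  have h2 : ∀ c : ZMod 2, c + c = 0 := by decide
  -- the off-diagonal shoelace areas of the rectangle
  have hS : ∀ a b : Fin d, a ≠ b → shoelaceParity π a b (rectWalk x i j R T) =
      (if b = i then (if a = j then ((R * T : ℕ) : ZMod 2) else 0) else 0) +
        if b = j then (if a = i then ((R * T : ℕ) : ZMod 2) else 0) else 0 := by
    intro a b hab
    simp only [rectWalk, shoelaceParity_append, shoelaceParity_copy, shoelaceParity_reverse hπ hab,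
      shoelaceParity_lineWalk hπ hab, parity_add_single_natCast hπ]
    by_cases hb : b = i
    · have hbj : ¬b = j := fun h => hij (hb.symm.trans h)
      simp only [if_pos hb, if_neg hbj, add_zero, zero_add]
      by_cases haj : a = j
      · simp only [if_pos haj]
        push_cast
        linear_combination (↑R * π a x) * h2 1
      · simp only [if_neg haj, add_zero]
        linear_combination (↑R * π a x) * h2 1
    · by_cases hbj : b = j
      · simp only [if_neg hb, if_pos hbj, zero_add]
        by_cases hai : a = i
        · simp only [if_pos hai]
          push_cast
          linear_combination (↑T * π a x) * h2 1
        · simp only [if_neg hai, add_zero]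
          linear_combination (↑T * π a x) * h2 1
      · simp only [if_neg hb, if_neg hbj, add_zero]
  unfold areaParity
  have hterm : ∀ a b : Fin d, (if a < b then shoelaceParity π a b (rectWalk x i j R T) else 0) =
      (if b = i then (if a = j ∧ j < i then ((R * T : ℕ) : ZMod 2) else 0) else 0) +
        if b = j then (if a = i ∧ i < j then ((R * T : ℕ) : ZMod 2) else 0) else 0 := by
    intro a b
    by_cases hab : a < b
    · rw [if_pos hab, hS a b (ne_of_lt hab)]
      congr 1
      · by_cases hb : b = i
        · have hc : ∀ c : ZMod 2, (if a = j then c else 0) = if a = j ∧ j < i then c else 0 :=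
            fun c => by
              by_cases haj : a = j
              · rw [if_pos haj, if_pos ⟨haj, (haj.symm.trans_lt hab).trans_eq hb⟩]
              · rw [if_neg haj, if_neg (fun h => haj h.1)]
          rw [if_pos hb, if_pos hb, hc]
        · rw [if_neg hb, if_neg hb]
      · by_cases hb : b = j
        · have hc : ∀ c : ZMod 2, (if a = i then c else 0) = if a = i ∧ i < j then c else 0 :=
            fun c => by
              by_cases hai : a = i
              · rw [if_pos hai, if_pos ⟨hai, (hai.symm.trans_lt hab).trans_eq hb⟩]
              · rw [if_neg hai, if_neg (fun h => hai h.1)]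
          rw [if_pos hb, if_pos hb, hc]
        · rw [if_neg hb, if_neg hb]
    · rw [if_neg hab]
      have z1 : (if b = i then (if a = j ∧ j < i then ((R * T : ℕ) : ZMod 2) else 0) else 0) = 0 := by
        split_ifs with h1 h2
        · exact absurd ((h2.1.trans_lt h2.2).trans_eq h1.symm) hab
        all_goals rfl
      have z2 : (if b = j then (if a = i ∧ i < j then ((R * T : ℕ) : ZMod 2) else 0) else 0) = 0 := by
        split_ifs with h1 h2
        · exact absurd ((h2.1.trans_lt h2.2).trans_eq h1.symm) hab
        all_goals rfl
      rw [z1, z2, add_zero]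
  simp only [hterm, Finset.sum_add_distrib, Finset.sum_ite_eq', Finset.mem_univ, if_true]
  have hand : ∀ (a c : Fin d) (P : Prop) [Decidable P] (v : ZMod 2),
      (if a = c ∧ P then v else 0) = if a = c then (if P then v else 0) else 0 := by
    intro a c P _ v; split_ifs <;> simp_all
  simp only [hand, Finset.sum_ite_eq', Finset.mem_univ, if_true]
  rcases lt_or_gt_of_ne hij with h | h
  · rw [if_neg (lt_asymm h), if_pos h, zero_add]
  · rw [if_pos h, if_neg (lt_asymm h), add_zero]

end Rectangle

end TiltedRP

end Summit.QuantumFields.GaugeBoot
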